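import Summits.CriticalPhenomena.PercolationContinuityZ3.Theorems.PercNonProliferationSubpolynomialBlockingSubsurfaceHarris
import Literature.Probability.Percolation.BoxGatewayRarity
import HarnessLib

/-!
# `SubpolynomialBlocking` — a sub-surface-order floor for critical annulus blocking (part II)

Support file for crux item stmt-CriticalPhenomena-4446 (`PercNonProliferation.SubpolynomialBlocking`:
`∀ s > 0, ∀ᶠ n, n^{-s} ≤ u_n`, `u_n = P_{p_c(ℤ³)}(Λ_n ↮ ∂ⁱⁿΛ_{2n} inside Λ_{2n}) = blockProb 3 p_c n`), line
`slab-ladder-two-curtains`, lead c2. It proves the crux's inequality with `e^{-ε n²}` in place of `n^{-s}`: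

  `subsurfaceBlocking : ∀ ε > 0, ∀ᶠ n, exp (-ε n²) ≤ u_n`,

i.e. `log (1/u_n) = o(n²)`. Before, the only lower bound in print or in tree was the SURFACE-ORDER floor
`u_n ≥ (1 - p_c)^{|∂_E Λ_n|} = e^{-Θ(n²)}` (`Negative.Strengthenings.pow_card_edgeBoundary_le_blockProb`, attained
at `n = 1`, `Negative.FloorAttained`; Disproof.lean §7: "nothing between `e^{-Cn²}` and `n^{-s}` is in print").
Part I (`…SubsurfaceHarris.lean`) gave `u_n ≥ c^{Σ_w a_w}`, `c = (1-p)^{2d}`, `a_w = P(w active)` over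
`w ∈ ∂ⁱⁿΛ_{2n-1}`. Here:

* CERF–DEMBIN SYMMETRY (2020, §2 (eq1); tree `BoxGateway.measure_openConnVia_box_le_halfSpaceReach`, now with
  the deep site existentially quantified): `a_w ≤ h_{n-1} := P_p(0 ↔ height ≥ n-1 inside ℍ)`
  (`real_active_le_halfSpaceReach`), so `u_n ≥ c^{|∂ⁱⁿΛ_{2n-1}| · h_{n-1}}` (`blockProb_ge_rpow`, every `d`, `p < 1`):
  any proved half-space one-arm RATE `h_t ≤ t^{-a}` transfers to `u_n ≥ exp(-C_d n^{d-1-a})`.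
* BARSKY–GRIMMETT–NEWMAN. `h_t → 0` iff `θ_ℍ(p) = 0` (`CerfDembinVanishing.tendsto_measure_halfSpaceReach`), which
  at `p_c(ℤ³)` is the tree's PROVED `BarskyGrimmettNewman1991_Z3_holds`; with `|∂ⁱⁿΛ_m| ≤ 2d(2m+1)^{d-1}` this is
  `log(1/u_n) = o(n^{d-1})` (`eventually_exp_le_blockProb`) and, at `d = 3`, `p = p_c`, `subsurfaceBlocking`.

What it does NOT give: the crux — `u_n ≥ n^{-s}` along these lines would need `h_n ≲ (log n)/n²`, not expected
(`h_n ≈ n^{-1}` numerically). Consistent with `Negative.AboveSix` (`e^{-o(n^{d-1})} ≤ K/n`).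

References: Barsky–Grimmett–Newman, PTRF 90 (1991) (Grimmett 1999, Thm. (7.35)); R. Cerf, B. Dembin, ECP 25
(2020), §2; G. Grimmett, Percolation (1999), §2.2.
-/

noncomputable section

namespace Summit.CriticalPhenomena.PercolationContinuityZ3.Theorems.SubpolynomialBlocking

open MeasureTheory Filter Topology
open Literature.Probability.Percolation Literature.Probability.LatticeModels
open Literature.Probability.Percolation.CerfDembinVanishing
open Literature.Probability.Percolation.DCT16
open Literature.Barriers.CriticalPhenomena
open Summit.CriticalPhenomena.PercolationContinuityZ3.Theorems.SubpolynomialBlocking.Negative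

namespace Subsurface

variable {d : ℕ}

/-! ## §1 Active boundary sites: transport to the half-space (Cerf–Dembin's symmetry) -/

/-- **An active boundary site percolates to height `t` in a half-space**: for `w ∈ ∂ⁱⁿΛ_m` and `t ≤ m`,
`P_p(∃ x ∈ Λ_{m-t}, w ↔ x inside Λ_m) ≤ P_p(A_t)`, `A_t = {0 ↔ height ≥ t inside ℍ}` — the lattice
automorphism `y ↦ σ(y - w)` of `BoxGateway.measure_openConnVia_box_le_halfSpaceReach` maps `w` to `0`,
`Λ_m` into `ℍ` and EVERY `t`-deep site to height `≥ t` (Cerf–Dembin 2020, §2 (eq1)). -/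
theorem measure_active_le_halfSpaceReach [NeZero d] (p : unitInterval) {m t : ℕ} {w : Site d}
    (hw : w ∈ innerBoundary (zdGraph d) (box d m)) (htm : t ≤ m) :
    bondPercolation (zdGraph d) p
        {ω | ∃ x ∈ box d (m - t), ω ∈ openConnVia (withinGraph (zdGraph d) ↑(box d m)) w x} ≤
      bondPercolation (zdGraph d) p (halfSpaceReach d t) := by
  obtain ⟨i, hi⟩ := exists_eq_of_mem_innerBoundary_box hw
  -- the sign of the reflection (depends on `w` only)
  obtain ⟨s, hsbox, hsx⟩ : ∃ s : ℤˣ, (∀ y ∈ box d m, 0 ≤ (s : ℤ) * (y i - w i)) ∧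
      ∀ x ∈ box d (m - t), (t : ℤ) ≤ (s : ℤ) * (x i - w i) := by
    have hcast : ((m - t : ℕ) : ℤ) = (m : ℤ) - t := by push_cast [Nat.cast_sub htm]; ring
    by_cases hwi : w i = (m : ℤ)
    · refine ⟨-1, fun y hy => ?_, fun x hx => ?_⟩
      · have := (mem_box.1 hy i).2
        rw [hwi]; push_cast; linarith
      · have hxi := mem_box.1 hx i
        rw [hcast] at hxi
        rw [hwi]; push_cast; linarith [hxi.2]
    · have hwi' : w i = -(m : ℤ) := hi.resolve_left hwi
      refine ⟨1, fun y hy => ?_, fun x hx => ?_⟩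
      · have := (mem_box.1 hy i).1
        rw [hwi']; push_cast; linarith
      · have hxi := mem_box.1 hx i
        rw [hcast] at hxi
        rw [hwi']; push_cast; linarith [hxi.1]
  -- the automorphism `ψ y = σ (y - w)`
  set π : Equiv.Perm (Fin d) := Equiv.swap i 0 with hπ
  set ψ : zdGraph d ≃g zdGraph d := (zdShiftIso (-w)).trans (zdSignedPermIso π fun _ => s) with hψ
  set e : Site d ≃ Site d := ψ.toEquiv with he
  have he_apply : ∀ y, e y = Site.signedPerm π (fun _ => s) (y + -w) := fun y => rfl
  have he0 : ∀ y, e y 0 = (s : ℤ) * (y i - w i) := fun y => by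
    rw [he_apply, Site.signedPerm_apply, hπ, Equiv.symm_swap, Equiv.swap_apply_right]
    simp [sub_eq_add_neg]
  have hew : e w = 0 := by rw [he_apply, add_neg_cancel, Site.signedPerm_zero]
  have hadj : ∀ u v, (zdGraph d).Adj (e u) (e v) ↔ (zdGraph d).Adj u v := fun u v => ψ.map_rel_iff'
  have hK : ∀ u v, (withinGraph (zdGraph d) (e '' ↑(box d m))).Adj (e u) (e v) ↔
      (withinGraph (zdGraph d) ↑(box d m)).Adj u v := fun u v => by
    simp only [withinGraph_adj, e.injective.mem_set_image, hadj u v]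
  have himg : e '' (↑(box d m) : Set (Site d)) ⊆ halfSpace d := by
    rintro _ ⟨y, hy, rfl⟩
    change 0 ≤ e y 0
    rw [he0]
    exact hsbox y hy
  -- the inclusion of events
  have hsub : {ω | ∃ x ∈ box d (m - t), ω ∈ openConnVia (withinGraph (zdGraph d) ↑(box d m)) w x} ⊆
      BondConfig.relabel (sym2Equiv e) ⁻¹' halfSpaceReach d t := by
    rintro ω ⟨x, hx, hω⟩
    have hxω : x ∈ openClusterIn (withinGraph (zdGraph d) ↑(box d m)) ω w := hω
    have hrel := openClusterIn_relabel e hK ω w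
    have hmem : e x ∈ openClusterIn (withinGraph (zdGraph d) (e '' ↑(box d m)))
        (BondConfig.relabel (sym2Equiv e) ω) 0 := by
      have h := Set.mem_image_of_mem e hxω
      rwa [← hrel, hew] at h
    refine ⟨e x, openClusterIn_mono_graph (withinGraph_mono _ himg) _ 0 hmem, ?_⟩
    rw [he0]
    exact hsx x hx
  calc bondPercolation (zdGraph d) p
        {ω | ∃ x ∈ box d (m - t), ω ∈ openConnVia (withinGraph (zdGraph d) ↑(box d m)) w x}
      ≤ bondPercolation (zdGraph d) p (BondConfig.relabel (sym2Equiv e) ⁻¹' halfSpaceReach d t) :=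
        measure_mono hsub
    _ = (bondPercolation (zdGraph d) p).map (BondConfig.relabel (sym2Equiv e)) (halfSpaceReach d t) :=
        (MeasurableEquiv.map_apply _ _).symm
    _ = bondPercolation (zdGraph d) p (halfSpaceReach d t) := by
        rw [he, bondPercolation_map_relabel_iso ψ p]

/-- Real-valued form: `P_p(w active) ≤ P_p(A_t)`. -/
theorem real_active_le_halfSpaceReach [NeZero d] (p : unitInterval) {m t : ℕ} {w : Site d}
    (hw : w ∈ innerBoundary (zdGraph d) (box d m)) (htm : t ≤ m) :
    (bondPercolation (zdGraph d) p).real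
        {ω | ∃ x ∈ box d (m - t), ω ∈ openConnVia (withinGraph (zdGraph d) ↑(box d m)) w x} ≤
      (bondPercolation (zdGraph d) p).real (halfSpaceReach d t) := by
  simp only [measureReal_def]
  exact ENNReal.toReal_mono (measure_ne_top _ _) (measure_active_le_halfSpaceReach p hw htm)

/-! ## §4 The probabilistic assembly (continued) -/

/-- **The sub-surface-order floor, quantitative form**: for `n ≥ 1` and `p < 1`,
`((1-p)^{2d})^{|∂ⁱⁿΛ_{2n-1}| · h_{n-1}} ≤ u_n(d,p)` where `h_t = P_p(0 ↔ height ≥ t inside ℍ)`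
(`CerfDembinVanishing.halfSpaceReach`): bound each activity probability by `h_{n-1}`
(`real_active_le_halfSpaceReach`, `t = n-1 ≤ m = 2n-1`) and use that `x ↦ c^x` is antitone for
`0 < c ≤ 1`. Any rate `h_t ≤ t^{-a}` thus gives `u_n ≥ exp(-C_d n^{d-1-a})`. -/
theorem blockProb_ge_rpow [NeZero d] (p : unitInterval) (hp1 : (p : ℝ) < 1) {n : ℕ} (hn : 1 ≤ n) :
    ((1 - (p : ℝ)) ^ (2 * d)) ^ (((innerBoundary (zdGraph d) (box d (2 * n - 1))).card : ℝ) *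
        (bondPercolation (zdGraph d) p).real (halfSpaceReach d (n - 1))) ≤
      blockProb d p n := by
  have hq0 : 0 < 1 - (p : ℝ) := by linarith
  have hq1 : 1 - (p : ℝ) ≤ 1 := by linarith [p.2.1]
  have hc0 : 0 < (1 - (p : ℝ)) ^ (2 * d) := pow_pos hq0 _
  have hc1 : (1 - (p : ℝ)) ^ (2 * d) ≤ 1 := pow_le_one₀ hq0.le hq1
  refine le_trans ?_ (blockProb_ge_rpow_sum p hp1 hn)
  refine Real.rpow_le_rpow_of_exponent_ge hc0 hc1 ?_
  have htm : n - 1 ≤ 2 * n - 1 := by omega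
  calc ∑ w ∈ innerBoundary (zdGraph d) (box d (2 * n - 1)),
        (bondPercolation (zdGraph d) p).real {ω | ∃ x ∈ box d (2 * n - 1 - (n - 1)),
          ω ∈ openConnVia (withinGraph (zdGraph d) ↑(box d (2 * n - 1))) w x}
      ≤ ∑ _w ∈ innerBoundary (zdGraph d) (box d (2 * n - 1)),
          (bondPercolation (zdGraph d) p).real (halfSpaceReach d (n - 1)) :=
        Finset.sum_le_sum fun w hw => real_active_le_halfSpaceReach p hw htm
    _ = ((innerBoundary (zdGraph d) (box d (2 * n - 1))).card : ℝ) *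
          (bondPercolation (zdGraph d) p).real (halfSpaceReach d (n - 1)) := by
        rw [Finset.sum_const, nsmul_eq_mul]

/-- `|∂ⁱⁿΛ_{2n-1}| ≤ 2d · 4^{d-1} · n^{d-1}` (from `card_innerBoundary_box_le`: `≤ 2d(2m+1)^{d-1}` and
`2(2n-1)+1 ≤ 4n` for `n ≥ 1`). -/
theorem card_innerBoundary_box_pred_le (hd : 1 ≤ d) {n : ℕ} (hn : 1 ≤ n) :
    ((innerBoundary (zdGraph d) (box d (2 * n - 1))).card : ℝ) ≤
      2 * d * 4 ^ (d - 1) * (n : ℝ) ^ (d - 1) := by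
  have h1 := card_innerBoundary_box_le (d := d) (2 * n - 1)
  have h2 : (2 * (2 * n - 1) + 1) ^ (d - 1) ≤ (4 * n) ^ (d - 1) :=
    Nat.pow_le_pow_left (by omega) _
  have h3 : (innerBoundary (zdGraph d) (box d (2 * n - 1))).card ≤ 2 * d * (4 * n) ^ (d - 1) :=
    h1.trans (Nat.mul_le_mul_left _ h2)
  have h4 : ((innerBoundary (zdGraph d) (box d (2 * n - 1))).card : ℝ) ≤
      ((2 * d * (4 * n) ^ (d - 1) : ℕ) : ℝ) := by exact_mod_cast h3
  refine h4.trans (le_of_eq ?_)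
  have : d - 1 + 1 = d := Nat.sub_add_cancel hd
  push_cast
  rw [mul_pow]
  ring

/-- **The sub-surface-order floor, asymptotic form**: if `θ_ℍ(p) = 0` (and `p < 1`, `d ≥ 1`), then for
every `ε > 0`, eventually `exp(-ε n^{d-1}) ≤ u_n(d,p)` — i.e. `log(1/u_n) = o(n^{d-1})`, strictly below the
surface order of the trivial floor `(1-p)^{|∂_E Λ_n|}`. Input: `P_p(A_t) → 0`
(`CerfDembinVanishing.tendsto_measure_halfSpaceReach`, Barsky–Grimmett–Newman via continuity from above). -/
theorem eventually_exp_le_blockProb [NeZero d] (hd : 1 ≤ d) (p : unitInterval) (hp1 : (p : ℝ) < 1)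
    (hθ : theta (halfSpaceGraph d) (halfSpaceOrigin d) p = 0) {ε : ℝ} (hε : 0 < ε) :
    ∀ᶠ n : ℕ in atTop, Real.exp (-(ε * (n : ℝ) ^ (d - 1))) ≤ blockProb d p n := by
  set c : ℝ := (1 - (p : ℝ)) ^ (2 * d) with hc
  have hq0 : 0 < 1 - (p : ℝ) := by linarith
  have hc0 : 0 < c := pow_pos hq0 _
  have hc1 : c ≤ 1 := pow_le_one₀ hq0.le (by linarith [p.2.1])
  have hlog : Real.log c ≤ 0 := Real.log_nonpos hc0.le hc1
  -- `h_t → 0` (real-valued), shifted to `t = n - 1`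
  have hlim : Tendsto (fun t : ℕ => (bondPercolation (zdGraph d) p).real (halfSpaceReach d t)) atTop (𝓝 0) := by
    have h' : Tendsto (fun t => ((bondPercolation (zdGraph d) p) (halfSpaceReach d t)).toReal) atTop
        (𝓝 (0 : ENNReal).toReal) :=
      (ENNReal.tendsto_toReal ENNReal.zero_ne_top).comp (tendsto_measure_halfSpaceReach p hθ)
    rw [ENNReal.toReal_zero] at h'
    simpa only [measureReal_def] using h'
  have hlim' : Tendsto (fun n : ℕ => (bondPercolation (zdGraph d) p).real (halfSpaceReach d (n - 1)))
      atTop (𝓝 0) :=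
    hlim.comp (tendsto_atTop_atTop.2 fun b => ⟨b + 1, fun a ha => by omega⟩)
  -- choose `δ` with `2d·4^{d-1}·δ·|log c| ≤ ε`
  set K : ℝ := 2 * d * 4 ^ (d - 1) with hK
  have hK0 : 0 < K := by rw [hK]; positivity
  set δ : ℝ := ε / (K * (|Real.log c| + 1)) with hδ
  have hδ0 : 0 < δ := by rw [hδ]; positivity
  have hev : ∀ᶠ n : ℕ in atTop, (bondPercolation (zdGraph d) p).real (halfSpaceReach d (n - 1)) < δ :=
    hlim'.eventually (gt_mem_nhds hδ0)
  filter_upwards [hev, eventually_ge_atTop 1] with n hn hn1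
  refine le_trans ?_ (blockProb_ge_rpow p hp1 hn1)
  set h : ℝ := (bondPercolation (zdGraph d) p).real (halfSpaceReach d (n - 1)) with hh
  have hh0 : 0 ≤ h := measureReal_nonneg
  set B : ℝ := ((innerBoundary (zdGraph d) (box d (2 * n - 1))).card : ℝ) with hB
  have hB0 : 0 ≤ B := by rw [hB]; positivity
  have hBle : B ≤ K * (n : ℝ) ^ (d - 1) := by rw [hB, hK]; exact card_innerBoundary_box_pred_le hd hn1
  -- `c^{B h} = exp (B h log c) ≥ exp (-ε n^{d-1})`
  rw [Real.rpow_def_of_pos hc0, Real.exp_le_exp]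
  have hn0 : (0 : ℝ) ≤ (n : ℝ) ^ (d - 1) := by positivity
  have key : B * h * |Real.log c| ≤ ε * (n : ℝ) ^ (d - 1) := by
    calc B * h * |Real.log c| ≤ (K * (n : ℝ) ^ (d - 1)) * δ * |Real.log c| := by
          gcongr
      _ = (K * δ * |Real.log c|) * (n : ℝ) ^ (d - 1) := by ring
      _ ≤ ε * (n : ℝ) ^ (d - 1) := by
          refine mul_le_mul_of_nonneg_right ?_ hn0
          rw [hδ]
          rw [show K * (ε / (K * (|Real.log c| + 1))) * |Real.log c| =
              ε * (|Real.log c| / (|Real.log c| + 1)) by field_simp]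
          refine mul_le_of_le_one_right hε.le ?_
          rw [div_le_one (by positivity)]
          linarith
  have habs : Real.log c = -|Real.log c| := by
    rw [abs_of_nonpos hlog]; ring
  rw [habs]
  nlinarith [key, mul_nonneg hB0 hh0]

end Subsurface

/-- **SUB-SURFACE-ORDER BLOCKING AT `p_c(ℤ³)`** (registered on crux stmt-CriticalPhenomena-4446, line
`slab-ladder-two-curtains`, lead c2): the crux's inequality with `e^{-ε n²}` in place of `n^{-s}` — for every
`ε > 0`, eventually in `n`,
`exp (-ε n²) ≤ P_{p_c}(no open path inside Λ_{2n} from Λ_n to ∂ⁱⁿΛ_{2n})`,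
i.e. `log (1/u_n) = o(n²)`, improving the surface-order floor `u_n ≥ (1-p_c)^{|∂_E Λ_n|} = e^{-Θ(n²)}`
(`Negative.Strengthenings.pow_card_edgeBoundary_le_blockProb`). Proof: `Subsurface.eventually_exp_le_blockProb`
at `d = 3` with the tree's proved Barsky–Grimmett–Newman theorem `θ_ℍ(p_c(ℤ³)) = 0`
(`BarskyGrimmettNewman1991_Z3_holds`) and `p_c(ℤ³) < 1` (`criticalProb_zd_lt_one`). The crux itself
(`n^{-s}`) would need the half-space one-arm rate `h_n ≲ (log n)/n²` along this route, which is not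
expected; the statement here is unconditional. -/
theorem subsurfaceBlocking :
    ∀ ε : ℝ, 0 < ε → ∀ᶠ n : ℕ in atTop,
      Real.exp (-(ε * (n : ℝ) ^ 2)) ≤
        (bondPercolation (zdGraph 3) (criticalProbI 3)).real
          {ω | ¬ ∃ x ∈ box 3 n, ∃ y ∈ innerBoundary (zdGraph 3) (box 3 (2 * n)),
            ω ∈ openConnIn ↑(box 3 (2 * n)) x y} := by
  intro ε hε
  have h := Subsurface.eventually_exp_le_blockProb (d := 3) (by norm_num) (criticalProbI 3)
    (criticalProb_zd_lt_one (by norm_num)) BarskyGrimmettNewman1991_Z3_holds hε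
  filter_upwards [h] with n hn
  exact hn

end Summit.CriticalPhenomena.PercolationContinuityZ3.Theorems.SubpolynomialBlocking

end
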